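import Summits.Ventures.YMGap.Census.TwistField
import HarnessLib

/-!
# Venture YMGap, track (b) — geometry of translated vortex sheets: relocation inside the homology class, position relative
# to the reflection hyperplanes, and transport under the lattice symmetries

HONEST FRAMING: venture file of the cell `pub-ymgap` (QuantumFields programme), track (b); finite tori `(ℤ/Lℤ)^d` only; pure
lattice combinatorics plus the mod-2 rule of `TwistField`; nothing about (5.15), limits, confinement or a mass gap.

Tomboulis, arXiv:0707.2179, §4 and App. A §2 use that the twisted partition function "depends only on the directions in which
`𝒱_{μν}` winds through the lattice, not the exact shape or location of `𝒱_{μν}`", and choose the location relative to a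
reflection hyperplane at will ("take `𝒱 ⊂ Λ_L`, and `𝒱' = R[𝒱] ⊂ Λ_R`").  The marked-plaquette transport of
`MarkedPlaquetteTransport` / `PatternMonotone` (transposition `0 ↔ μ` followed by a translation) carries Tomboulis's sheet
`𝒱_{01}` to a GENERAL translated sheet; this file records (i) the two-parameter translated sheets `sheetAt i j a b`
(`(i,j)`-plaquettes with base coordinates `x_i = a`, `x_j = b`), (ii) that two parallel sheets differing in the FIRST coordinate
cobound a link set (so the twisted FIELD partition functions agree, `coefFieldZ_twistField_sheetAt_fst`), (iii) that a sheet in a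
plane containing the time axis and based at time `0` consists of crossing plaquettes, while a sheet in a plane not containing
the time axis contains no crossing plaquette and is invariant under the reflection of plaquettes, and (iv) the image of a
`(0,1)`-sheet under the transport symmetries is again a sheet, in the plane `(0,1)` or `(1,μ)`.

References: E. T. Tomboulis, arXiv:0707.2179, §4 (text after (4.1)) and App. A §2 [cite: Tomboulis2007Confinement, §4 and
App. A §2].
-/

noncomputable section

open MeasureTheory Finset Real
open scoped BigOperators symmDiff
open Literature.MathematicalPhysics.QuantumLattice
open Literature.MathematicalPhysics.QuantumFieldTheory
open Literature.MathematicalPhysics.QuantumFieldTheory.Tomboulis2007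
open Literature.MathematicalPhysics.QuantumFieldTheory.WilsonRP

namespace Summit.Ventures.YMGap.Census

variable {d L : ℕ}

/-! ### Two-parameter translated sheets -/

/-- **The vortex sheet of the `(i, j)` plane at position `(x_i, x_j) = (a, b)`**: all `(i, j)`-plaquettes whose base point has
`i`-coordinate `a` and `j`-coordinate `b` (Tomboulis's `𝒱_{ij}` is `(a, b) = (0, 0)`; `VortexTwistCohomology.vortexSheetAt a` is
`b = 0`). -/
def sheetAt [NeZero L] (i j : Fin d) (hij : i < j) (a b : ZMod L) : Finset (Plaquette d L) :=
  univ.filter fun p => p.2 = ⟨(i, j), hij⟩ ∧ p.1 i = a ∧ p.1 j = b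

variable [NeZero L]

/-- Membership in a translated sheet. -/
theorem mem_sheetAt {i j : Fin d} (hij : i < j) (a b : ZMod L) (p : Plaquette d L) :
    p ∈ sheetAt i j hij a b ↔ p.2 = ⟨(i, j), hij⟩ ∧ p.1 i = a ∧ p.1 j = b := by
  simp [sheetAt]

/-- `sheetAt i j a 0` is `vortexSheetAt a`. -/
theorem sheetAt_zero_right {i j : Fin d} (hij : i < j) (a : ZMod L) :
    sheetAt i j hij a 0 = vortexSheetAt L a i j hij := by
  ext p
  simp [sheetAt, vortexSheetAt]

/-- Tomboulis's `𝒱_{ij}` is `sheetAt i j 0 0`. -/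
theorem vortexSheet_eq_sheetAt {i j : Fin d} (hij : i < j) : vortexSheet L i j hij = sheetAt i j hij 0 0 := by
  ext p
  simp [sheetAt, vortexSheet]

/-! ### Relocation in the first coordinate: adjacent parallel sheets cobound a link set -/

/-- The `j`-links between the sheets at `(a, b)` and `(a + 1, b)`: `(x, j)` with `x_i = a + 1`, `x_j = b`. -/
def sheetLinksAt (i j : Fin d) (a b : ZMod L) : Finset (Edge d L) :=
  univ.filter fun e => e.2 = j ∧ e.1 i = a + 1 ∧ e.1 j = b

/-- Membership in `sheetLinksAt` (plumbing). -/
theorem mem_sheetLinksAt (i j : Fin d) (a b : ZMod L) (y : Site d L) (m : Fin d) :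
    (y, m) ∈ sheetLinksAt i j a b ↔ m = j ∧ y i = a + 1 ∧ y j = b := by
  simp [sheetLinksAt]

omit [NeZero L] in
/-- `𝟙_P + 𝟙_Q` is odd iff exactly one of `P`, `Q` holds (plumbing). -/
theorem odd_ite_add_ite' (P Q : Prop) [Decidable P] [Decidable Q] :
    Odd ((if P then 1 else 0) + (if Q then 1 else 0) : ℕ) ↔ (P ∧ ¬Q ∨ Q ∧ ¬P) := by
  by_cases hP : P <;> by_cases hQ : Q <;> simp [hP, hQ, Nat.odd_iff]

omit [NeZero L] in
/-- `𝟙_P + 𝟙_P` is even (plumbing). -/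
theorem not_odd_ite_add_self' (P : Prop) [Decidable P] :
    ¬Odd ((if P then 1 else 0) + (if P then 1 else 0) : ℕ) := by
  by_cases hP : P <;> simp [hP, Nat.odd_iff]

/-- **`δ(sheetLinksAt a b) = sheet(a, b) ∆ sheet(a+1, b)`** (as `VortexTwistCohomology.coboundary_sheetLinks`, at a general
second coordinate `b`). -/
theorem coboundary_sheetLinksAt {i j : Fin d} (hij : i < j) (a b : ZMod L) :
    coboundary (sheetLinksAt (L := L) i j a b) = sheetAt i j hij a b ∆ sheetAt i j hij (a + 1) b := by
  ext p
  rcases p with ⟨y, ⟨⟨a', b'⟩, hab⟩⟩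
  rw [mem_coboundary, Finset.mem_symmDiff, mem_sheetAt, mem_sheetAt]
  simp only [flipCount, linkInd, mem_sheetLinksAt]
  by_cases hb : b' = j
  · subst hb
    by_cases ha : a' = i
    · subst ha
      have h1 : (y.shift a') a' = y a' + 1 := by simp [Site.shift]
      have h2 : (y.shift a') b' = y b' := by simp [Site.shift, Pi.single_eq_of_ne hij.ne']
      simp only [h1, h2, hij.ne, false_and, if_false, zero_add, add_zero, add_left_inj, true_and]
      exact odd_ite_add_ite' _ _
    · have hne : ¬((⟨(a', b'), hab⟩ : {p : Fin d × Fin d // p.1 < p.2}) = ⟨(i, b'), hij⟩) := by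
        intro h
        exact ha (congrArg (fun q : {p : Fin d × Fin d // p.1 < p.2} => q.1.1) h)
      have h1 : (y.shift a') i = y i := by simp [Site.shift, Pi.single_eq_of_ne (Ne.symm ha)]
      have h2 : (y.shift a') b' = y b' := by simp [Site.shift, Pi.single_eq_of_ne hab.ne']
      simp only [h1, h2, hab.ne, hne, false_and, if_false, zero_add, add_zero, true_and, not_false_iff,
        and_true, or_self, iff_false]
      exact not_odd_ite_add_self' _
  · by_cases ha : a' = j
    · subst ha
      have hne : ¬((⟨(a', b'), hab⟩ : {p : Fin d × Fin d // p.1 < p.2}) = ⟨(i, a'), hij⟩) := by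
        intro h
        exact hb (congrArg (fun q : {p : Fin d × Fin d // p.1 < p.2} => q.1.2) h)
      have h1 : (y.shift b') i = y i := by
        simp [Site.shift, Pi.single_eq_of_ne (hij.trans hab).ne]
      have h2 : (y.shift b') a' = y a' := by simp [Site.shift, Pi.single_eq_of_ne hab.ne]
      simp only [h1, h2, hb, hne, false_and, if_false, add_zero, true_and, not_false_iff,
        and_true, or_self, iff_false]
      exact not_odd_ite_add_self' _
    · have hne : ¬((⟨(a', b'), hab⟩ : {p : Fin d × Fin d // p.1 < p.2}) = ⟨(i, j), hij⟩) := by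
        intro h
        exact hb (congrArg (fun q : {p : Fin d × Fin d // p.1 < p.2} => q.1.2) h)
      simp [ha, hb, hne]

/-- The coboundary of the empty link set is empty (plumbing). -/
theorem coboundary_empty' : coboundary (∅ : Finset (Edge d L)) = ∅ := by
  ext p
  simp [mem_coboundary, flipCount, linkInd]

/-- **Two parallel sheets differing in the first coordinate cobound a link set**: for all `a`, `b`, `n` there is `E` with
`δE = sheet(a, b) ∆ sheet(a + n, b)`. -/
theorem exists_coboundary_eq_sheetAt_add {i j : Fin d} (hij : i < j) (a b : ZMod L) (n : ℕ) :
    ∃ E : Finset (Edge d L), coboundary E = sheetAt i j hij a b ∆ sheetAt i j hij (a + (n : ZMod L)) b := by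
  induction n with
  | zero => exact ⟨∅, by rw [coboundary_empty', Nat.cast_zero, add_zero, symmDiff_self]; rfl⟩
  | succ n ih =>
    obtain ⟨E, hE⟩ := ih
    refine ⟨E ∆ sheetLinksAt i j (a + (n : ZMod L)) b, ?_⟩
    rw [coboundary_symmDiff, hE, coboundary_sheetLinksAt hij, Nat.cast_succ, ← add_assoc, symmDiff_assoc,
      symmDiff_symmDiff_cancel_left]

/-- The same for two arbitrary first coordinates `a`, `a'`. -/
theorem exists_coboundary_eq_sheetAt_fst {i j : Fin d} (hij : i < j) (a a' b : ZMod L) :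
    ∃ E : Finset (Edge d L), coboundary E = sheetAt i j hij a b ∆ sheetAt i j hij a' b := by
  obtain ⟨E, hE⟩ := exists_coboundary_eq_sheetAt_add (L := L) hij a b (a' - a).val
  rw [ZMod.natCast_zmod_val, add_sub_cancel] at hE
  exact ⟨E, hE⟩

/-- **Relocation of the twist in the first coordinate does not change a twisted FIELD partition function**:
`Z(twistField sheet(a,b) F) = Z(twistField sheet(a',b) F)` for every field `F`. -/
theorem coefFieldZ_twistField_sheetAt_fst (J : ℕ) (F : Plaquette d L → ℕ → ℝ) {i j : Fin d} (hij : i < j)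
    (a a' b : ZMod L) :
    coefFieldZ J (twistField (sheetAt i j hij a b) F) = coefFieldZ J (twistField (sheetAt i j hij a' b) F) := by
  obtain ⟨E, hE⟩ := exists_coboundary_eq_sheetAt_fst (L := L) hij a a' b
  exact coefFieldZ_twistField_congr_coboundary J F E hE.symm

/-! ### Position of a sheet relative to the reflection hyperplanes -/

section Reflect

variable [NeZero d]

omit [NeZero L] in
/-- The reflection of plaquettes does not change the plane. -/
theorem plaqReflect_snd (p : Plaquette d L) : (plaqReflect p).2 = p.2 := by
  unfold plaqReflect
  split_ifs <;> rfl

omit [NeZero L] in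
/-- The reflection of plaquettes does not change the spatial coordinates of the base point. -/
theorem plaqReflect_fst_apply_of_ne (p : Plaquette d L) {k : Fin d} (hk : k ≠ 0) : (plaqReflect p).1 k = p.1 k := by
  unfold plaqReflect
  split_ifs
  · simp [timeReflect_apply_of_ne _ hk, shift_apply_of_ne _ hk]
  · simp [timeReflect_apply_of_ne _ hk]

/-- **A sheet in a plane not containing the time axis contains no crossing plaquette.** -/
theorem not_isCrossPlaq_of_mem_sheetAt {i j : Fin d} (hij : i < j) (hi : i ≠ 0) {a b : ZMod L} {p : Plaquette d L}
    (hp : p ∈ sheetAt i j hij a b) : ¬ IsCrossPlaq p := by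
  intro hc
  have h2 := ((mem_sheetAt hij a b p).1 hp).1
  have : p.2.1.1 = i := by rw [h2]
  exact hi (this ▸ hc.1)

/-- **A sheet in a plane not containing the time axis is invariant under the reflection of plaquettes.** -/
theorem plaqReflect_mem_sheetAt_iff {i j : Fin d} (hij : i < j) (hi : i ≠ 0) (a b : ZMod L) (p : Plaquette d L) :
    plaqReflect p ∈ sheetAt i j hij a b ↔ p ∈ sheetAt i j hij a b := by
  have hj : j ≠ 0 := fun h => by
    rw [h] at hij
    exact (Fin.not_lt_zero i) hij
  rw [mem_sheetAt, mem_sheetAt, plaqReflect_snd, plaqReflect_fst_apply_of_ne p hi, plaqReflect_fst_apply_of_ne p hj]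

/-- **A sheet in a plane `(0, j)` based at time `0` consists of crossing plaquettes** (it is bisected by the hyperplane
`x_0 = 1/2`). -/
theorem isCrossPlaq_of_mem_sheetAt_zero {j : Fin d} (h0j : (0 : Fin d) < j) {b : ZMod L} {p : Plaquette d L}
    (hp : p ∈ sheetAt 0 j h0j 0 b) : IsCrossPlaq p := by
  obtain ⟨h2, h0, -⟩ := (mem_sheetAt h0j 0 b p).1 hp
  refine ⟨by rw [h2], Or.inl ?_⟩
  rw [h0, ZMod.val_zero]

end Reflect

/-! ### Transport of a `(0,1)`-sheet under `q ↦ plaqTranspose 0 μ (plaqShift (-v) q)` -/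

section Transport

variable [NeZero d]

omit [NeZero d] [NeZero L] in
/-- `dirTranspose` is an involution (from `plaqTranspose_plaqTranspose'`). -/
theorem dirTranspose_dirTranspose' (μ ν : Fin d) (q : {p : Fin d × Fin d // p.1 < p.2}) :
    dirTranspose μ ν (dirTranspose μ ν q) = q := by
  haveI : NeZero (1 : ℕ) := ⟨one_ne_zero⟩
  have h := plaqTranspose_plaqTranspose' (L := 1) μ ν ((fun _ => 0), q)
  exact congrArg Prod.snd h

omit [NeZero d] [NeZero L] in
/-- `dirTranspose μ ν X = Y ↔ X = dirTranspose μ ν Y`. -/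
theorem dirTranspose_eq_iff (μ ν : Fin d) (X Y : {p : Fin d × Fin d // p.1 < p.2}) :
    dirTranspose μ ν X = Y ↔ X = dirTranspose μ ν Y := by
  constructor
  · intro h; rw [← h, dirTranspose_dirTranspose']
  · intro h; rw [h, dirTranspose_dirTranspose']

omit [NeZero L] in
/-- `dirTranspose 0 0` is the identity on the pair `(0, 1)`… in fact on every pair. -/
theorem dirTranspose_zero_zero (q : {p : Fin d × Fin d // p.1 < p.2}) : dirTranspose (0 : Fin d) 0 q = q := by
  obtain ⟨⟨a, b⟩, hab⟩ := q
  unfold dirTranspose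
  simp only [Equiv.swap_self, Equiv.refl_apply]
  rw [dif_pos hab]

omit [NeZero L] in
/-- `dirTranspose 0 1 (0, 1) = (0, 1)`. -/
theorem dirTranspose_zero_one_pair (h01 : (0 : Fin d) < 1) :
    dirTranspose (0 : Fin d) 1 ⟨((0 : Fin d), (1 : Fin d)), h01⟩ = ⟨((0 : Fin d), (1 : Fin d)), h01⟩ := by
  unfold dirTranspose
  simp only [Equiv.swap_apply_left, Equiv.swap_apply_right]
  rw [dif_neg (lt_asymm h01)]

omit [NeZero L] in
/-- `dirTranspose 0 μ (0, 1) = (1, μ)` for `1 < μ`. -/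
theorem dirTranspose_zero_pair_of_lt (h01 : (0 : Fin d) < 1) {μ : Fin d} (h1μ : (1 : Fin d) < μ) :
    dirTranspose (0 : Fin d) μ ⟨((0 : Fin d), (1 : Fin d)), h01⟩ = ⟨((1 : Fin d), μ), h1μ⟩ := by
  have hμ0 : μ ≠ 0 := (h01.trans h1μ).ne'
  have hμ1 : μ ≠ 1 := h1μ.ne'
  have hs0 : Equiv.swap (0 : Fin d) μ 0 = μ := Equiv.swap_apply_left _ _
  have hs1 : Equiv.swap (0 : Fin d) μ 1 = 1 := Equiv.swap_apply_of_ne_of_ne h01.ne' (Ne.symm hμ1)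
  unfold dirTranspose
  simp only [hs0, hs1]
  rw [dif_neg (lt_asymm h1μ)]

omit [NeZero L] in
/-- `siteTranspose 0 0` is the identity. -/
theorem siteTranspose_zero_zero (y : Site d L) : siteTranspose (0 : Fin d) 0 y = y := by
  funext m
  simp [siteTranspose, Equiv.swap_self]

omit [NeZero d] [NeZero L] in
/-- A coordinate fixed by the transposition is unchanged. -/
theorem siteTranspose_apply_of_ne_of_ne {μ ν k : Fin d} (hkμ : k ≠ μ) (hkν : k ≠ ν) (y : Site d L) :
    siteTranspose μ ν y k = y k := by
  simp [siteTranspose, Equiv.swap_apply_of_ne_of_ne hkμ hkν]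

/-- **The pull-back of a `(0,1)`-sheet along the transport symmetry is a sheet, in the plane `(0,1)` or `(1,μ)`.**  For every
`μ`, `v`, `a`, `b` there are `k < l` with `k = 0 ∨ k = 1` and `a'`, `b'` such that
`plaqTranspose 0 μ (plaqShift (-v) q) ∈ sheet_{01}(a, b) ↔ q ∈ sheet_{kl}(a', b')` for all plaquettes `q`. -/
theorem exists_sheetAt_transport (h01 : (0 : Fin d) < 1) (μ : Fin d) (v : Site d L) (a b : ZMod L) :
    ∃ (k l : Fin d) (hkl : k < l) (a' b' : ZMod L), (k = 0 ∨ k = 1) ∧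
      ∀ q : Plaquette d L, plaqTranspose 0 μ (plaqShift (-v) q) ∈ sheetAt 0 1 h01 a b ↔ q ∈ sheetAt k l hkl a' b' := by
  by_cases hμ0 : μ = 0
  · subst hμ0
    refine ⟨0, 1, h01, a + v 0, b + v 1, Or.inl rfl, fun q => ?_⟩
    rw [mem_sheetAt, mem_sheetAt]
    simp only [plaqTranspose, plaqShift, siteTranspose_zero_zero, dirTranspose_zero_zero, Pi.add_apply, Pi.neg_apply]
    constructor
    · rintro ⟨h2, ha, hb⟩; exact ⟨h2, by rw [← ha]; ring, by rw [← hb]; ring⟩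
    · rintro ⟨h2, ha, hb⟩; exact ⟨h2, by rw [ha]; ring, by rw [hb]; ring⟩
  by_cases hμ1 : μ = 1
  · subst hμ1
    refine ⟨0, 1, h01, b + v 0, a + v 1, Or.inl rfl, fun q => ?_⟩
    rw [mem_sheetAt, mem_sheetAt]
    simp only [plaqTranspose, plaqShift, siteTranspose_apply_left, siteTranspose_apply_right, Pi.add_apply, Pi.neg_apply]
    rw [dirTranspose_eq_iff, dirTranspose_zero_one_pair h01]
    constructor
    · rintro ⟨h2, ha, hb⟩; exact ⟨h2, by rw [← hb]; ring, by rw [← ha]; ring⟩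
    · rintro ⟨h2, ha, hb⟩; exact ⟨h2, by rw [hb]; ring, by rw [ha]; ring⟩
  · have h1μ : (1 : Fin d) < μ := by
      have h0 : 0 < μ.val := Nat.pos_of_ne_zero fun h => hμ0 (Fin.ext (by rw [h, Fin.val_zero]))
      have hle : (1 : Fin d) ≤ μ := by
        rw [Fin.le_def, Fin.val_one']
        exact (Nat.mod_le 1 d).trans h0
      exact lt_of_le_of_ne hle (Ne.symm hμ1)
    refine ⟨1, μ, h1μ, b + v 1, a + v μ, Or.inr rfl, fun q => ?_⟩
    rw [mem_sheetAt, mem_sheetAt]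
    have hk1 : siteTranspose (0 : Fin d) μ (q.1 + -v) 1 = (q.1 + -v) 1 :=
      siteTranspose_apply_of_ne_of_ne h01.ne' (Ne.symm hμ1) _
    simp only [plaqTranspose, plaqShift, siteTranspose_apply_left, hk1, Pi.add_apply, Pi.neg_apply]
    rw [dirTranspose_eq_iff, dirTranspose_zero_pair_of_lt h01 h1μ]
    constructor
    · rintro ⟨h2, ha, hb⟩; exact ⟨h2, by rw [← hb]; ring, by rw [← ha]; ring⟩
    · rintro ⟨h2, ha, hb⟩; exact ⟨h2, by rw [hb]; ring, by rw [ha]; ring⟩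

end Transport

/-! ### The master positivity lemma: `Z(G) + Z(G⁻) ≥ 0` for the twist on ANY translated sheet -/

section Master

variable [NeZero d] [Fact (1 < L)]

/-- **`0 ≤ Z(G) + Z(twistField sheet G)` for every translated sheet and every field `G` that is mirror-symmetric off the
crossing plaquettes and non-negative on them** (`L` even).  A sheet in a plane `(0, l)` is first relocated to time `0` inside
its homology class (`coefFieldZ_twistField_sheetAt_fst`), where it is bisected by the reflection hyperplane and the even-sector
expansion applies (`coefFieldZ_add_twist_nonneg_of_cross`); a sheet in a plane not containing the time axis is reflection
invariant and off the hyperplanes, so both `Z(G)` and `Z(G⁻)` are `≥ 0` (`coefFieldZ_nonneg`, `coefFieldZ_twist_nonneg_of_reflect`). -/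
theorem coefFieldZ_add_twist_sheetAt_nonneg (hL : Even L) (J : ℕ) {G : Plaquette d L → ℕ → ℝ}
    (hG : ∀ p, ¬ IsCrossPlaq p → G (plaqReflect p) = G p) (hGpos : ∀ p, IsCrossPlaq p → ∀ n, 0 ≤ G p n)
    {k l : Fin d} (hkl : k < l) (a b : ZMod L) :
    0 ≤ coefFieldZ J G + coefFieldZ J (twistField (sheetAt k l hkl a b) G) := by
  by_cases hk : k = 0
  · subst hk
    rw [coefFieldZ_twistField_sheetAt_fst J G hkl a 0 b]
    exact coefFieldZ_add_twist_nonneg_of_cross hL J (fun p hp => isCrossPlaq_of_mem_sheetAt_zero hkl hp) hG hGpos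
  · exact add_nonneg (coefFieldZ_nonneg hL J hG hGpos)
      (coefFieldZ_twist_nonneg_of_reflect hL J (fun p hp => not_isCrossPlaq_of_mem_sheetAt hkl hk hp)
        (fun p _ => plaqReflect_mem_sheetAt_iff hkl hk a b p) hG hGpos)

/-- **Transported form.**  If the pull-back `q ↦ [σ⁻¹ q ∈ sheet_{01}(a, b)]` of the twist set along
`σ⁻¹ = plaqTranspose 0 μ ∘ plaqShift (-v)` is used to twist a field `G` as above, the conclusion persists:
`0 ≤ Z(G) + Z(twistField {q | σ⁻¹ q ∈ sheet_{01}(a,b)} G)`. -/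
theorem coefFieldZ_add_twist_transport_nonneg (hL : Even L) (J : ℕ) {G : Plaquette d L → ℕ → ℝ}
    (hG : ∀ p, ¬ IsCrossPlaq p → G (plaqReflect p) = G p) (hGpos : ∀ p, IsCrossPlaq p → ∀ n, 0 ≤ G p n)
    (h01 : (0 : Fin d) < 1) (μ : Fin d) (v : Site d L) (a b : ZMod L) :
    0 ≤ coefFieldZ J G +
      coefFieldZ J (twistField (univ.filter fun q => plaqTranspose 0 μ (plaqShift (-v) q) ∈ sheetAt 0 1 h01 a b) G) := by
  obtain ⟨k, l, hkl, a', b', -, hiff⟩ := exists_sheetAt_transport (L := L) h01 μ v a b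
  have hset : (univ.filter fun q => plaqTranspose 0 μ (plaqShift (-v) q) ∈ sheetAt 0 1 h01 a b) = sheetAt k l hkl a' b' := by
    ext q
    simp only [Finset.mem_filter, Finset.mem_univ, true_and]
    exact hiff q
  rw [hset]
  exact coefFieldZ_add_twist_sheetAt_nonneg hL J hG hGpos hkl a' b'

end Master

end Summit.Ventures.YMGap.Census

end
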